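import Mathlib
import HarnessLib
import Summits.HubbardSuperconductivity.HubbardSuperconductivity.Theorems.KLProgrammeKLRegimeTwoVolumeBlockDefectStep
import Literature.MathematicalPhysics.QuantumLattice.GrassmannWeightedEffectiveActionBound
import Literature.Probability.LatticeModels.SubmultiplicativeTreeWeight

/-!
# Route `KLProgramme` — crux K3, the nested two-volume pass (β′): the block-defect step with the (m4) kernel data DISCHARGED — nested two-volume
# closeness at a deep pin from ONE-VOLUME data only (cell gate-hubbard-kl, seat hubbard-kl-k3c4-p1 g7)

`…TwoVolumeBlockDefectStep.sum_norm_kernel_sub_copies_le` (this seat) still took the single-scale kernel data of the intermediate fine-algebra actions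
`𝒱_s := effAction (s•D_far) W^dec` (profiles `nV`, first moments `mV`, `mL`) and `W₁ := effAction D_far W^dec` (profile `Nn`).  Here they are
DERIVED from the decay-weighted single-scale step `GrassmannWeightedEffectiveActionBound.sum_wt_norm_kernel_effAction_le` run on `(s•D_far, W^dec)` with the
tree weight `1 + diam` of the COARSE pseudo-distance pulled back along the block projection (so that the glued action's weighted profile IS the coarse
one — the fine torus distance would see the seams of the boxes), leaving as inputs ONLY one-volume data:

* the coarse action's diameter-weighted all-degree pinned profile `Nw` (`Σ_{Y_j = x} ‖kernel (effAction C V) (2m′) Y‖·(1 + diam_{dc} Y) ≤ Nw m′` — the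
  (E1)₀/(E4)₀-type output at ONE volume), a coarse label pseudo-distance `dc` (`IsLabelDist`),
* decay numbers of the two covariances: sups `s, s′`, row sums `α, α′`, `dc`-first moments `m₁, m₁′`, the row tail `T` of `C′` on `Far`, charged Gram forms,
* the block structure `e`, periodisation (P), geometry (G1)/(G2), a pin `w` with `R_f ≤ dc(π X, π w)` on the zone,
* two smallness conditions (`θw < 1` for the far/profile step at field weight `ρf`, `θn < 1` for the near step at `ρn`) and a nilpotency index `k`.

* `contr_smul_eq_inner` (the charged Gram form of `s•D`, `s ∈ [0,1]`), `sum_weight_norm_copies_row` (weighted rows of `C^cop` are weighted rows of `C`),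
  **`sum_norm_kernel_sub_copies_le_of_profile`** — the statement.

Sorry-free; no definition.  References: BETA-PRIME-ROADMAP.md (k3c5-p2 g5) (m4); BGM 2006 (2.13)–(2.14), (2.77)–(2.80), §3 (3.2)–(3.8).
-/

noncomputable section

namespace Summit.HubbardSuperconductivity.HubbardSuperconductivity.Theorems.TwoVolumeDefect

set_option linter.dupNamespace false -- summit = problem name (single-conjunct summit), D-0017

open Finset Literature.MathematicalPhysics.QuantumLattice GrassmannAlgebra Literature.Probability.LatticeModels
  Literature.Probability.LatticeModels.BattleFederbush
open scoped Nat InnerProductSpace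

variable {𝕜 : Type*} [RCLike 𝕜]

/-- **The charged Gram form of `s • D`, `s ∈ [0,1]`**: both vectors rescaled by `√s` (cf. `isGramBoundedR_smul_of_gram`). [folklore] -/
theorem contr_smul_eq_inner {Γ' : Type*} [Fintype Γ'] {ED : Type*} [NormedAddCommGroup ED] [InnerProductSpace 𝕜 ED]
    (D : Matrix Γ' Γ' 𝕜) (FD GD : Γ' → ED) {X Y : Γ'} (hFG : contr 𝕜 D X Y = ⟪FD X, GD Y⟫_𝕜) {s : ℝ} (hs0 : 0 ≤ s) :
    contr 𝕜 (s • D) X Y = ⟪((Real.sqrt s : ℝ) : 𝕜) • FD X, ((Real.sqrt s : ℝ) : 𝕜) • GD Y⟫_𝕜 := by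
  rw [inner_smul_left, inner_smul_right, RCLike.conj_ofReal, ← mul_assoc, ← RCLike.ofReal_mul, Real.mul_self_sqrt hs0, ← hFG]
  have h : (s • D) = ((s : ℝ) : 𝕜) • D := by
    ext X' Y'; simp [Matrix.smul_apply, RCLike.real_smul_eq_coe_mul]
  rw [h, contr_smul_apply']

/-- Norm of a `√s`-rescaled vector, `s ∈ [0,1]`. [folklore] -/
theorem norm_sqrt_smul_le {ED : Type*} [NormedAddCommGroup ED] [InnerProductSpace 𝕜 ED] {x : ED} {κ s : ℝ} (hx : ‖x‖ ≤ κ)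
    (hs1 : s ≤ 1) : ‖((Real.sqrt s : ℝ) : 𝕜) • x‖ ≤ κ := by
  have hsq : Real.sqrt s ≤ 1 := Real.sqrt_le_one.mpr hs1
  rw [norm_smul, RCLike.norm_ofReal, abs_of_nonneg (Real.sqrt_nonneg _)]
  exact (mul_le_mul hsq hx (norm_nonneg _) zero_le_one).trans_eq (one_mul κ)

/-- **Weighted rows of the copies covariance are weighted rows of `C`** (weight read at the projected column). [folklore] -/
theorem sum_weight_norm_copies_row {Γ ι Γ' : Type*} [Fintype Γ] [Fintype Γ'] [Fintype ι] [DecidableEq ι] (e : Γ' ≃ ι × Γ)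
    (C : Matrix Γ Γ 𝕜) (Ccop : Matrix Γ' Γ' 𝕜)
    (hCcop : ∀ X' Y', Ccop X' Y' = if (e X').1 = (e Y').1 then C (e X').2 (e Y').2 else 0) (wφ : Γ → ℝ) (X' : Γ') :
    ∑ Y', ‖Ccop X' Y'‖ * wφ (e Y').2 = ∑ Y, ‖C (e X').2 Y‖ * wφ Y := by
  have h : ∀ Y', ‖Ccop X' Y'‖ * wφ (e Y').2 = (fun p : ι × Γ => if (e X').1 = p.1 then ‖C (e X').2 p.2‖ * wφ p.2 else 0) (e Y') := by
    intro Y'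
    simp only [hCcop]
    split_ifs <;> simp
  simp_rw [h]
  rw [e.sum_comp (fun p : ι × Γ => if (e X').1 = p.1 then ‖C (e X').2 p.2‖ * wφ p.2 else 0), Fintype.sum_prod_type]
  simp

/-- For antisymmetric `C`, `C′` the far defect is antisymmetric in norm. [folklore] -/
theorem norm_far_swap {Γ ι Γ' : Type*} [DecidableEq ι] (e : Γ' ≃ ι × Γ) (C : Matrix Γ Γ 𝕜) (C' Ccop Df : Matrix Γ' Γ' 𝕜)
    (Zs : Set Γ') [DecidablePred (· ∈ Zs)]
    (hCcop : ∀ X' Y', Ccop X' Y' = if (e X').1 = (e Y').1 then C (e X').2 (e Y').2 else 0)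
    (hDf : ∀ X' Y', Df X' Y' = if X' ∈ Zs ∧ Y' ∈ Zs then C' X' Y' - Ccop X' Y' else 0)
    (hC't : ∀ X' Y', C' Y' X' = -C' X' Y') (hCt : ∀ X Y, C Y X = -C X Y) (X' Y' : Γ') :
    ‖Df Y' X'‖ = ‖Df X' Y'‖ := by
  have h : Df Y' X' = -Df X' Y' := by
    by_cases hz : X' ∈ Zs ∧ Y' ∈ Zs
    · rw [hDf, if_pos hz.symm, hDf, if_pos hz, hCcop, hCcop, hC't X' Y']
      by_cases hb : (e X').1 = (e Y').1
      · rw [if_pos hb.symm, if_pos hb, hCt (e X').2 (e Y').2]; abel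
      · rw [if_neg (fun h => hb h.symm), if_neg hb]; abel
    · rw [hDf, if_neg (fun h => hz h.symm), hDf, if_neg hz, neg_zero]
  rw [h, norm_neg]

/-- **NESTED TWO-VOLUME CLOSENESS AT A DEEP PIN FROM ONE-VOLUME DATA.**  `sum_norm_kernel_sub_copies_le` with the kernel data of
`𝒱_s = effAction (s•D_far) W^dec` and `W₁` derived from the decay-weighted single-scale step (weight `1 + diam` of the pulled-back coarse
pseudo-distance `dc`): with `B m := ρf^{-m}·e·normV(κ_D, ρf, Nw)/(1 − θw)`, in every degree `n+1`, at the pin `w`,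
`Σ_{X : X_p = w} ‖kernel (effAction C′ (Σ_β V∘f_β)) (n+1) X − kernel (Σ_β (effAction C V)∘f_β) (n+1) X‖ ≤ NEAR(T, √(κ_D²+κ_D²), Nn := B) + FAR(s′+s, α′+α, R_f, nV = mV = mL := B)`.
[folklore; BGM 2006 (2.13)–(2.14), (2.77)–(2.80), §3 (3.2)–(3.8)] -/
theorem sum_norm_kernel_sub_copies_le_of_profile {Γ ι : Type*} [Fintype Γ] [DecidableEq Γ] [Fintype ι] [DecidableEq ι]
    {Γ' : Type} [LinearOrder Γ'] [Fintype Γ']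
    {E E' : Type*} [NormedAddCommGroup E] [InnerProductSpace 𝕜 E] [NormedAddCommGroup E'] [InnerProductSpace 𝕜 E']
    (e : Γ' ≃ ι × Γ) (C : Matrix Γ Γ 𝕜) (C' Ccop Dn Df : Matrix Γ' Γ' 𝕜) (Zs : Set Γ') [DecidablePred (· ∈ Zs)]
    (hCcop : ∀ X' Y', Ccop X' Y' = if (e X').1 = (e Y').1 then C (e X').2 (e Y').2 else 0)
    (hDf : ∀ X' Y', Df X' Y' = if X' ∈ Zs ∧ Y' ∈ Zs then C' X' Y' - Ccop X' Y' else 0)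
    (hDn : ∀ X' Y', Dn X' Y' = if X' ∈ Zs ∧ Y' ∈ Zs then 0 else C' X' Y' - Ccop X' Y')
    -- (P) periodisation, (G1)/(G2) geometry, row tail
    (hP : ∀ (X' : Γ') (Y : Γ), ∑ Y'' ∈ univ.filter (fun Y'' : Γ' => (e Y'').2 = Y), C' X' Y'' = C (e X').2 Y)
    (Far : Γ' → Γ' → Prop) [∀ X' Y', Decidable (Far X' Y')]
    (hG1 : ∀ X' Y', (e X').1 ≠ (e Y').1 → ¬ (X' ∈ Zs ∧ Y' ∈ Zs) → Far X' Y')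
    (hG2 : ∀ X' Y' Y'', (e X').1 = (e Y').1 → (e Y'').2 = (e Y').2 → Y'' ≠ Y' → ¬ (X' ∈ Zs ∧ Y' ∈ Zs) → Far X' Y'')
    {T : ℝ} (hT0 : 0 < T) (hT : ∀ X', ∑ Y' ∈ univ.filter (fun Y' : Γ' => Far X' Y'), ‖C' X' Y'‖ ≤ T)
    -- antisymmetry and decay numbers of `C`, `C′`
    (hCt : ∀ X Y, C Y X = -C X Y) (hC't : ∀ X' Y', C' Y' X' = -C' X' Y')
    {s s' : ℝ} (hs0 : 0 ≤ s) (hs'0 : 0 ≤ s') (hs : ∀ X Y, ‖C X Y‖ ≤ s) (hs' : ∀ X' Y', ‖C' X' Y'‖ ≤ s')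
    {α α' : ℝ} (hαα : 0 < α' + α) (hrow : ∀ X, ∑ Y, ‖C X Y‖ ≤ α) (hrow' : ∀ X', ∑ Y', ‖C' X' Y'‖ ≤ α')
    (dc : Γ → Γ → ℝ) (hdc : IsLabelDist dc) {m₁ m₁' : ℝ} (hm0 : 0 ≤ m₁) (hm0' : 0 ≤ m₁')
    (hm1 : ∀ X, ∑ Y, ‖C X Y‖ * dc X Y ≤ m₁) (hm1' : ∀ X', ∑ Y', ‖C' X' Y'‖ * dc (e X').2 (e Y').2 ≤ m₁')
    -- charges and charged Gram forms
    (q : Γ → Bool) (hCq : ∀ X Y, q X = q Y → C X Y = 0) (hC'q : ∀ X' Y', q (e X').2 = q (e Y').2 → C' X' Y' = 0)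
    (f g : Γ → E) (f' g' : Γ' → E') {κ κ' κD : ℝ} (hκD0 : 0 < κD) (hκD : Real.sqrt (κ' ^ 2 + κ ^ 2) ≤ κD)
    (hf : ∀ X, q X = true → ‖f X‖ ≤ κ) (hg : ∀ Y, q Y = false → ‖g Y‖ ≤ κ)
    (hf' : ∀ X', q (e X').2 = true → ‖f' X'‖ ≤ κ') (hg' : ∀ Y', q (e Y').2 = false → ‖g' Y'‖ ≤ κ')
    (hG : ∀ X Y, q X = true → q Y = false → contr 𝕜 C X Y = ⟪f X, g Y⟫_𝕜)
    (hG' : ∀ X' Y', q (e X').2 = true → q (e Y').2 = false → contr 𝕜 C' X' Y' = ⟪f' X', g' Y'⟫_𝕜)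
    -- the pin, far from the zone in the pulled-back coarse distance
    {Rf : ℝ} (hRf : 0 < Rf) (w : Γ') (hdR : ∀ X, X ∈ Zs → Rf ≤ dc (e X).2 (e w).2)
    -- the coarse interaction and the block embeddings
    (Fe : ι → (Γ → 𝕜) →ₗ[𝕜] (Γ' → 𝕜)) (hFe : ∀ β v X', Fe β v X' = if (e X').1 = β then v (e X').2 else 0)
    {V : GrassmannAlgebra 𝕜 Γ} (hVe : V ∈ evenOdd 𝕜 0) (hV0 : constPart 𝕜 V = 0) (hZ : IsUnit (effPartitionFn 𝕜 C V))
    -- the coarse diameter-weighted all-degree profile and the two smallness conditions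
    (Nw : ℕ → ℝ) (hNw0 : ∀ m, 0 ≤ Nw m)
    (hNw : ∀ (m' : ℕ) (j : Fin (2 * m')) (x : Γ), ∑ Y ∈ univ.filter (fun Y : Fin (2 * m') → Γ => Y j = x),
      ‖kernel 𝕜 (effAction 𝕜 C V) (2 * m') Y‖ * (1 + labelDiam dc (univ.image Y)) ≤ Nw m')
    {ρf : ℝ} (hρf : 0 < ρf) (hθw : Real.exp 1 * (α' + α + (m₁' + m₁)) * normV Γ' κD ρf Nw / κD ^ 2 < 1)
    {ρn : ℝ} (hρn : 0 < ρn)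
    (hθn : Real.exp 1 * (2 * T) * normV Γ' (Real.sqrt (κD ^ 2 + κD ^ 2)) ρn
        (fun m' => ρf⁻¹ ^ (2 * m') * (Real.exp 1 * normV Γ' κD ρf Nw) /
          (1 - Real.exp 1 * (α' + α + (m₁' + m₁)) * normV Γ' κD ρf Nw / κD ^ 2)) / Real.sqrt (κD ^ 2 + κD ^ 2) ^ 2 < 1)
    {k : ℕ} (hk : grassmannLaplacian 𝕜 Dn ^ k = 0) (n : ℕ) (p : Fin (n + 1)) :
    ∑ X ∈ univ.filter (fun X : Fin (n + 1) → Γ' => X p = w),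
        ‖kernel 𝕜 (effAction 𝕜 C' (∑ β, ExteriorAlgebra.map (Fe β) V)) (n + 1) X -
          kernel 𝕜 (∑ β, ExteriorAlgebra.map (Fe β) (effAction 𝕜 C V)) (n + 1) X‖ ≤
      (∑ j ∈ Ico 1 k, ((n + 1 + 2 * j)! : ℝ) / (((n + 1) ! : ℝ) * (j ! : ℝ) * 2 ^ j) * T ^ j *
            (ρf⁻¹ ^ (n + 1 + 2 * j) * (Real.exp 1 * normV Γ' κD ρf Nw) /
              (1 - Real.exp 1 * (α' + α + (m₁' + m₁)) * normV Γ' κD ρf Nw / κD ^ 2)) +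
          ρn⁻¹ ^ (n + 1) * (Real.exp 1 * normV Γ' (Real.sqrt (κD ^ 2 + κD ^ 2)) ρn
            (fun m' => ρf⁻¹ ^ (2 * m') * (Real.exp 1 * normV Γ' κD ρf Nw) /
              (1 - Real.exp 1 * (α' + α + (m₁' + m₁)) * normV Γ' κD ρf Nw / κD ^ 2))) *
            (Real.exp 1 * (2 * T) * normV Γ' (Real.sqrt (κD ^ 2 + κD ^ 2)) ρn
                (fun m' => ρf⁻¹ ^ (2 * m') * (Real.exp 1 * normV Γ' κD ρf Nw) /
                  (1 - Real.exp 1 * (α' + α + (m₁' + m₁)) * normV Γ' κD ρf Nw / κD ^ 2)) /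
                Real.sqrt (κD ^ 2 + κD ^ 2) ^ 2) /
              (1 - Real.exp 1 * (2 * T) * normV Γ' (Real.sqrt (κD ^ 2 + κD ^ 2)) ρn
                (fun m' => ρf⁻¹ ^ (2 * m') * (Real.exp 1 * normV Γ' κD ρf Nw) /
                  (1 - Real.exp 1 * (α' + α + (m₁' + m₁)) * normV Γ' κD ρf Nw / κD ^ 2)) /
                Real.sqrt (κD ^ 2 + κD ^ 2) ^ 2)) +
        ((((n + 1 + 1) * (n + 1 + 2) : ℕ) : ℝ) / 2 * ((s' + s) / Rf) *
            (ρf⁻¹ ^ (n + 3) * (Real.exp 1 * normV Γ' κD ρf Nw) /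
              (1 - Real.exp 1 * (α' + α + (m₁' + m₁)) * normV Γ' κD ρf Nw / κD ^ 2)) +
          ‖(2 : 𝕜)⁻¹‖ * ∑ a ∈ range (n + 2), ∑ b ∈ range (n + 2),
            (if a + b = n + 1 then (((a + 1) * (b + 1) : ℕ) : ℝ) *
              ((α' + α) *
                  (ρf⁻¹ ^ (a + 1) * (Real.exp 1 * normV Γ' κD ρf Nw) /
                      (1 - Real.exp 1 * (α' + α + (m₁' + m₁)) * normV Γ' κD ρf Nw / κD ^ 2) / Rf) *
                  (ρf⁻¹ ^ (b + 1) * (Real.exp 1 * normV Γ' κD ρf Nw) /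
                    (1 - Real.exp 1 * (α' + α + (m₁' + m₁)) * normV Γ' κD ρf Nw / κD ^ 2)) +
                (α' + α) *
                  (ρf⁻¹ ^ (a + 1) * (Real.exp 1 * normV Γ' κD ρf Nw) /
                    (1 - Real.exp 1 * (α' + α + (m₁' + m₁)) * normV Γ' κD ρf Nw / κD ^ 2)) *
                  (ρf⁻¹ ^ (b + 1) * (Real.exp 1 * normV Γ' κD ρf Nw) /
                      (1 - Real.exp 1 * (α' + α + (m₁' + m₁)) * normV Γ' κD ρf Nw / κD ^ 2) / Rf)) else 0)) := by
  classical
  -- notation: the smallness and the profile bound of the weighted step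
  set θw : ℝ := Real.exp 1 * (α' + α + (m₁' + m₁)) * normV Γ' κD ρf Nw / κD ^ 2 with hθw_def
  set B : ℕ → ℝ := fun m => ρf⁻¹ ^ m * (Real.exp 1 * normV Γ' κD ρf Nw) / (1 - θw) with hB_def
  have hnormV0 : 0 ≤ normV Γ' κD ρf Nw := normV_nonneg hκD0.le hρf.le hNw0
  have hαw : 0 < α' + α + (m₁' + m₁) := by linarith
  have hθw0 : 0 ≤ θw := by positivity
  have hB0 : ∀ m, 0 ≤ B m := fun m => by
    have : 0 < 1 - θw := by linarith
    positivity
  -- the decoupled reference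
  obtain ⟨hZ', hA'⟩ := effAction_copies_sum e C Ccop hCcop Fe hFe hVe hV0 hZ (univ : Finset ι)
  have hV'e : (∑ β, ExteriorAlgebra.map (Fe β) V) ∈ evenPart 𝕜 Γ' :=
    (mem_evenPart_iff).2 (Submodule.sum_mem _ fun β _ => map_blockEmb_mem_evenOdd_zero hVe)
  have hV'0 : constPart 𝕜 (∑ β, ExteriorAlgebra.map (Fe β) V) = 0 := by
    rw [map_sum]; exact sum_eq_zero fun β _ => by rw [constPart_map, hV0]
  set Wdec : GrassmannAlgebra 𝕜 Γ' := effAction 𝕜 Ccop (∑ β, ExteriorAlgebra.map (Fe β) V) with hWdec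
  have hWe : Wdec ∈ evenPart 𝕜 Γ' := effAction_mem_evenPart Ccop hV'e hV'0
  have hW0 : constPart 𝕜 Wdec = 0 := constPart_effAction 𝕜 Ccop _ hZ'
  -- column sums from row sums
  have hcol : ∀ Y, ∑ X, ‖C X Y‖ ≤ α := fun Y => by
    have h : ∀ X, ‖C X Y‖ = ‖C Y X‖ := fun X => by rw [hCt Y X, norm_neg]
    simp_rw [h]; exact hrow Y
  have hcol' : ∀ Y', ∑ X', ‖C' X' Y'‖ ≤ α' := fun Y' => by
    have h : ∀ X', ‖C' X' Y'‖ = ‖C' Y' X'‖ := fun X' => by rw [hC't Y' X', norm_neg]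
    simp_rw [h]; exact hrow' Y'
  -- the charged Gram form of `D = C′ − C^cop`, its zone restriction, charge selection
  set FD : Γ' → WithLp 2 (E' × PiLp 2 (fun _ : ι => E)) := fun X' =>
    WithLp.toLp 2 (f' X', (WithLp.toLp 2 (Pi.single (e X').1 (f (e X').2)) : PiLp 2 (fun _ : ι => E))) with hFD
  set GD : Γ' → WithLp 2 (E' × PiLp 2 (fun _ : ι => E)) := fun Y' =>
    WithLp.toLp 2 (g' Y', -(WithLp.toLp 2 (Pi.single (e Y').1 (g (e Y').2)) : PiLp 2 (fun _ : ι => E))) with hGD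
  have hκ'D : ∀ X', q (e X').2 = true → ‖FD X'‖ ≤ κD :=
    fun X' hX => (norm_gramD_fst_le e f f' X' (hf' X' hX) (hf _ hX)).trans hκD
  have hκ'Dg : ∀ Y', q (e Y').2 = false → ‖GD Y'‖ ≤ κD :=
    fun Y' hY => (norm_gramD_snd_le e g g' Y' (hg' Y' hY) (hg _ hY)).trans hκD
  have hFG : ∀ X' Y', q (e X').2 = true → q (e Y').2 = false → contr 𝕜 (C' - Ccop) X' Y' = ⟪FD X', GD Y'⟫_𝕜 :=
    fun X' Y' hX hY => contr_sub_copies_eq_inner e q C C' Ccop hCcop f g f' g' hG hG' X' Y' hX hY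
  have hqf : ∀ X Y, (fun X' => q (e X').2) X = (fun X' => q (e X').2) Y → Df X Y = 0 :=
    fun X Y h => (far_near_apply_of_charge_eq e q C C' Ccop Dn Df Zs hCcop hDf hDn hCq hC'q X Y h).1
  have hqn : ∀ X Y, q (e X).2 = q (e Y).2 → Dn X Y = 0 :=
    fun X Y h => (far_near_apply_of_charge_eq e q C C' Ccop Dn Df Zs hCcop hDf hDn hCq hC'q X Y h).2
  set Ff : Γ' → WithLp 2 (E' × PiLp 2 (fun _ : ι => E)) := fun X' => if X' ∈ Zs then FD X' else 0 with hFf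
  set Gf : Γ' → WithLp 2 (E' × PiLp 2 (fun _ : ι => E)) := fun Y' => if Y' ∈ Zs then GD Y' else 0 with hGf
  have hFfn : ∀ X', q (e X').2 = true → ‖Ff X'‖ ≤ κD := fun X' hX => norm_ite_mem_le Zs FD X' hκD0.le (hκ'D X' hX)
  have hGfn : ∀ Y', q (e Y').2 = false → ‖Gf Y'‖ ≤ κD := fun Y' hY => norm_ite_mem_le Zs GD Y' hκD0.le (hκ'Dg Y' hY)
  have hFGf : ∀ X' Y', q (e X').2 = true → q (e Y').2 = false → contr 𝕜 Df X' Y' = ⟪Ff X', Gf Y'⟫_𝕜 :=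
    fun X' Y' hX hY => contr_far_eq_inner_of_form C' Ccop Df Zs hDf FD GD (hFG X' Y' hX hY)
  -- the tree weight: `1 + diam` of the pulled-back coarse pseudo-distance
  set wt : Finset Γ' → ℝ := fun S => diamWeight (fun t => (1 + (1 : ℝ) * t) ^ 1) dc (S.image fun X' => (e X').2) with hwt_def
  have hwt : IsTreeWeight wt := (isTreeWeight_polyDiamWeight hdc zero_le_one 1).comap fun X' => (e X').2
  have hpair : ∀ X' Y' : Γ', wt {X', Y'} = 1 + dc (e X').2 (e Y').2 := fun X' Y' => by
    simp only [hwt_def, image_insert, image_singleton, diamWeight_pair hdc, one_mul, pow_one]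
  have hwt_apply : ∀ S : Finset Γ', wt S = 1 + labelDiam dc (S.image fun X' => (e X').2) := fun S => by
    simp only [hwt_def, diamWeight, one_mul, pow_one]
  -- the weighted profile of the decoupled action is the coarse weighted profile
  have hNf : ∀ (m' : ℕ) (j : Fin (2 * m')) (x : Γ'),
      ∑ Y ∈ univ.filter (fun Y : Fin (2 * m') → Γ' => Y j = x), ‖kernel 𝕜 Wdec (2 * m') Y‖ * wt (univ.image Y) ≤ Nw m' := by
    intro m' j x
    rw [hA', sum_pinned_kernel_copies_sum e Fe hFe (effAction 𝕜 C V) j x (fun Y r => ‖r‖ * wt (univ.image Y))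
      (fun _ => by rw [norm_zero, zero_mul])]
    refine le_trans (le_of_eq (sum_congr rfl fun Y _ => ?_)) (hNw m' j (e x).2)
    rw [hwt_apply, Finset.image_image]
    have hcomp : ((fun X' => (e X').2) ∘ fun i => e.symm ((e x).1, Y i)) = Y := by
      funext i
      simp
    rw [hcomp]
  have hNf' : ∀ (m' : ℕ) (j : Fin (2 * m')) (x : Γ'),
      ∑ Y ∈ univ.filter (fun Y : Fin (2 * m') → Γ' => Y j = x), ‖kernel 𝕜 Wdec (2 * m') Y‖ ≤ Nw m' :=
    fun m' j x => (sum_norm_le_sum_norm_mul_wt hwt _ _).trans (hNf m' j x)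
  -- weighted rows / columns of `s • Df`
  have hDfrow : ∀ X', ∑ Y', ‖Df X' Y'‖ * (1 + dc (e X').2 (e Y').2) ≤ α' + α + (m₁' + m₁) := by
    intro X'
    have h1 : ∑ Y', ‖C' X' Y'‖ * (1 + dc (e X').2 (e Y').2) ≤ α' + m₁' := by
      have : ∑ Y', ‖C' X' Y'‖ * (1 + dc (e X').2 (e Y').2) = ∑ Y', ‖C' X' Y'‖ + ∑ Y', ‖C' X' Y'‖ * dc (e X').2 (e Y').2 := by
        rw [← sum_add_distrib]; exact sum_congr rfl fun Y' _ => by ring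
      rw [this]; exact add_le_add (hrow' X') (hm1' X')
    have h2 : ∑ Y', ‖Ccop X' Y'‖ * (1 + dc (e X').2 (e Y').2) ≤ α + m₁ := by
      rw [sum_weight_norm_copies_row e C Ccop hCcop (fun Y => 1 + dc (e X').2 Y) X']
      have : ∑ Y, ‖C (e X').2 Y‖ * (1 + dc (e X').2 Y) = ∑ Y, ‖C (e X').2 Y‖ + ∑ Y, ‖C (e X').2 Y‖ * dc (e X').2 Y := by
        rw [← sum_add_distrib]; exact sum_congr rfl fun Y _ => by ring
      rw [this]; exact add_le_add (hrow _) (hm1 _)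
    calc ∑ Y', ‖Df X' Y'‖ * (1 + dc (e X').2 (e Y').2)
        ≤ ∑ Y', (‖C' X' Y'‖ * (1 + dc (e X').2 (e Y').2) + ‖Ccop X' Y'‖ * (1 + dc (e X').2 (e Y').2)) := by
          refine sum_le_sum fun Y' _ => ?_
          rw [← add_mul]
          exact mul_le_mul_of_nonneg_right (norm_far_le_add C' Ccop Df Zs hDf X' Y') (by linarith [hdc.nonneg (e X').2 (e Y').2])
      _ = ∑ Y', ‖C' X' Y'‖ * (1 + dc (e X').2 (e Y').2) + ∑ Y', ‖Ccop X' Y'‖ * (1 + dc (e X').2 (e Y').2) := sum_add_distrib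
      _ ≤ (α' + m₁') + (α + m₁) := add_le_add h1 h2
      _ = α' + α + (m₁' + m₁) := by ring
  have hsrow : ∀ s ∈ Set.Icc (0 : ℝ) 1, ∀ X', ∑ Y', ‖(s • Df) X' Y'‖ * wt {X', Y'} ≤ α' + α + (m₁' + m₁) := by
    intro s hs X'
    refine le_trans (sum_le_sum fun Y' _ => ?_) (hDfrow X')
    rw [hpair, Matrix.smul_apply, norm_smul, Real.norm_eq_abs, abs_of_nonneg hs.1]
    have h1 : s * ‖Df X' Y'‖ ≤ ‖Df X' Y'‖ := by nlinarith [norm_nonneg (Df X' Y'), hs.2]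
    exact mul_le_mul_of_nonneg_right h1 (by linarith [hdc.nonneg (e X').2 (e Y').2])
  have hscol : ∀ s ∈ Set.Icc (0 : ℝ) 1, ∀ Y', ∑ X', ‖(s • Df) X' Y'‖ * wt {X', Y'} ≤ α' + α + (m₁' + m₁) := by
    intro s hs Y'
    have h : ∀ X', ‖(s • Df) X' Y'‖ * wt {X', Y'} = ‖(s • Df) Y' X'‖ * wt {Y', X'} := fun X' => by
      rw [Matrix.smul_apply, Matrix.smul_apply, norm_smul, norm_smul, norm_far_swap e C C' Ccop Df Zs hCcop hDf hC't hCt Y' X',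
        Finset.pair_comm]
    simp_rw [h]
    exact hsrow s hs Y'
  -- the decay-weighted single-scale step on `(s • Df, W^dec)`
  have hstep : ∀ s ∈ Set.Icc (0 : ℝ) 1, ∀ {m : ℕ}, 0 < m → ∀ (i : Fin m) (x : Γ'),
      ∑ W ∈ univ.filter (fun W : Fin m → Γ' => W i = x), wt (univ.image W) * ‖kernel 𝕜 (effAction 𝕜 (s • Df) Wdec) m W‖ ≤ B m := by
    intro s hs m hm i x
    have hsq : ∀ X Y, (fun X' => q (e X').2) X = (fun X' => q (e X').2) Y → (s • Df) X Y = 0 :=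
      fun X Y h => by rw [Matrix.smul_apply, hqf X Y h, smul_zero]
    have h := (sum_wt_norm_kernel_effAction_le (s • Df) hwt (fun X' => q (e X').2) hsq
      (fun X' => ((Real.sqrt s : ℝ) : 𝕜) • Ff X') (fun Y' => ((Real.sqrt s : ℝ) : 𝕜) • Gf Y') hκD0
      (fun X' hX => norm_sqrt_smul_le (hFfn X' hX) hs.2) (fun Y' hY => norm_sqrt_smul_le (hGfn Y' hY) hs.2)
      (fun X' Y' hX hY => contr_smul_eq_inner Df Ff Gf (hFGf X' Y' hX hY) hs.1)
      Wdec hWe hW0 Nw hNw0 hNf hαw (hsrow s hs) (hscol s hs) hρf hθw).2 hm i x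
    simpa only [hB_def, hθw_def] using h
  -- the far distance to the pin is dominated by the weight
  have hd_le_wt : ∀ {m : ℕ} (U : Fin m → Γ') (a b : Fin m), U a = w → dc (e (U b)).2 (e w).2 ≤ wt (univ.image U) := by
    intro m U a b ha
    rw [hwt_apply, ← ha]
    have h := le_labelDiam dc (S := (univ.image U).image fun X' => (e X').2) (a := (e (U b)).2) (b := (e (U a)).2)
      (mem_image_of_mem _ (mem_image_of_mem U (mem_univ b))) (mem_image_of_mem _ (mem_image_of_mem U (mem_univ a)))
    linarith [labelDiam_nonneg dc ((univ.image U).image fun X' => (e X').2)]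
  -- feed k3c5-p2's defect step
  have hθf : Real.exp 1 * (α' + α) * normV Γ' κD ρf Nw / κD ^ 2 < 1 := by
    refine lt_of_le_of_lt ?_ hθw
    have : Real.exp 1 * (α' + α) * normV Γ' κD ρf Nw ≤ Real.exp 1 * (α' + α + (m₁' + m₁)) * normV Γ' κD ρf Nw :=
      mul_le_mul_of_nonneg_right (mul_le_mul_of_nonneg_left (by linarith) (Real.exp_pos 1).le) hnormV0
    exact div_le_div_of_nonneg_right this (by positivity)
  have hVs0 : ∀ s ∈ Set.Icc (0 : ℝ) 1, ∀ (m : ℕ) (x : Γ'),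
      ∑ U ∈ univ.filter (fun U : Fin (m + 1) → Γ' => U 0 = x), ‖kernel 𝕜 (effAction 𝕜 (s • Df) Wdec) (m + 1) U‖ ≤ B (m + 1) := by
    intro s hs m x
    refine le_trans (sum_le_sum fun U _ => ?_) (hstep s hs (Nat.succ_pos m) 0 x)
    exact le_mul_of_one_le_left (norm_nonneg _) (hwt.one_le _)
  have hVsm : ∀ s ∈ Set.Icc (0 : ℝ) 1, ∀ (m : ℕ) (i : Fin m),
      ∑ U ∈ univ.filter (fun U : Fin (m + 1) → Γ' => U i.succ = w),
        dc (e (U 0)).2 (e w).2 * ‖kernel 𝕜 (effAction 𝕜 (s • Df) Wdec) (m + 1) U‖ ≤ B (m + 1) := by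
    intro s hs m i
    refine le_trans (sum_le_sum fun U hU => ?_) (hstep s hs (Nat.succ_pos m) i.succ w)
    simp only [mem_filter, mem_univ, true_and] at hU
    exact mul_le_mul_of_nonneg_right (hd_le_wt U i.succ 0 hU) (norm_nonneg _)
  have hVsL : ∀ s ∈ Set.Icc (0 : ℝ) 1,
      ∑ Z ∈ univ.filter (fun Z : Fin (n + 1 + 1 + 1) → Γ' => Z (Fin.castSucc (Fin.castSucc p)) = w),
        dc (e (Z (Fin.last (n + 1 + 1)))).2 (e w).2 * ‖kernel 𝕜 (effAction 𝕜 (s • Df) Wdec) (n + 1 + 2) Z‖ ≤ B (n + 3) := by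
    intro s hs
    refine le_trans (sum_le_sum fun Z hZ => ?_) (hstep s hs (by omega) (Fin.castSucc (Fin.castSucc p)) w)
    simp only [mem_filter, mem_univ, true_and] at hZ
    exact mul_le_mul_of_nonneg_right (hd_le_wt Z _ _ hZ) (norm_nonneg _)
  have hNn : ∀ (m : ℕ) (j : Fin m) (x : Γ'), ∑ Z ∈ univ.filter (fun Z : Fin m → Γ' => Z j = x),
      ‖kernel 𝕜 (effAction 𝕜 Df Wdec) m Z‖ ≤ B m := by
    intro m j x
    have h1 := hstep 1 ⟨zero_le_one, le_rfl⟩ (Fin.pos j) j x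
    rw [one_smul] at h1
    refine le_trans (sum_le_sum fun Z _ => ?_) h1
    exact le_mul_of_one_le_left (norm_nonneg _) (hwt.one_le _)
  have hdec : C' = Ccop + Dn + Df := (copies_add_near_add_far C' Ccop Dn Df Zs hDf hDn).symm
  rw [hdec, ← hA']
  exact sum_norm_kernel_twoVolumeDefect_le Ccop Dn Df _ hV'e hV'0 hZ' (fun X' => q (e X').2) hqf Ff Gf hκD0 hFfn hGfn hFGf
    (fun X' Y' h => far_apply_of_not C' Ccop Df Zs hDf h) (by positivity)
    (fun X' Y' => norm_far_le e C C' Ccop Df Zs hCcop hDf hs'0 hs0 hs' hs X' Y') hαα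
    (fun X' => sum_norm_far_row_le e C C' Ccop Df Zs hCcop hDf hrow' hrow X')
    (fun Y' => sum_norm_far_col_le e C C' Ccop Df Zs hCcop hDf hcol' hcol Y')
    (fun X => dc (e X).2 (e w).2) (fun X => hdc.nonneg _ _) hRf hdR w Nw hNw0 hNf' hρf hθf B B B hB0 hB0 hVs0 hVsm n p hVsL
    (by positivity) (isGramBoundedR_near_of_form e q C' Ccop Dn Zs hDn hqn FD GD hκD0.le hκ'D hκ'Dg hFG) (by positivity)
    (fun X' => sum_norm_near_row_le e C C' Ccop Dn Zs hCcop hDn hP Far hG1 hG2 hT X')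
    (fun Y' => sum_norm_near_col_le e C C' Ccop Dn Zs hCcop hDn hP hC't hCt Far hG1 hG2 hT Y')
    (fun X' Y' => norm_near_le e C C' Ccop Dn Zs hCcop hDn hP Far hG1 hG2 hT X' Y') B hB0 hNn hρn hθn hk

end Summit.HubbardSuperconductivity.HubbardSuperconductivity.Theorems.TwoVolumeDefect

end
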